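import Literature.AlgebraicGeometry.KTheory.CoherentGrothendieckGroupFlatPullback
import Literature.AlgebraicGeometry.KTheory.CoherentGrothendieckGroupModule
import Literature.AlgebraicGeometry.KTheory.CoherentGrothendieckGroupRank
import Literature.AlgebraicGeometry.Modules.PullbackTensorProductHolds
import Literature.AlgebraicGeometry.Modules.PullbackStalk
import HarnessLib

/-!
# Flat pull-back on `K'₀` is `K₀`-linear and preserves the generic rank

Layer `Literature/AlgebraicGeometry/KTheory` (theorems only: no definition, no named fact, no instance). Compatibilities of
the flat pull-back `f^* : K'₀(Y) → K'₀(X)` on Grothendieck groups of coherent sheaves (`KZeroCoh.pullback`,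
`KTheory/CoherentGrothendieckGroupFlatPullback`; Görtz–Wedhorn II Remark/Def. 23.53) with

* the `K₀`-module structure `[E] • [F] = [E ⊗ F]` (`KZeroCoh.smulHom`, `KTheory/CoherentGrothendieckGroupModule`; Görtz–Wedhorn
  II Def. 23.52 (2), Fulton §15.1 "`K⁰X ⊗ K₀X → K₀X`"): **`pullback_smulHom` — `f^*(x • y) = f^*x • f^*y`** for every flat
  morphism of locally noetherian schemes, `f^*` on `K₀` being the tree's `KZero.map f` (Fulton §15.1: `f^*` is a ring
  homomorphism and the projection formula context); on generators this is `f^*(E ⊗ F) ≅ f^*E ⊗ f^*F` (The Stacks Project,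
  Tag 01CD, the tree's theorem `Modules.PullbackTensorObjIso_holds`);
* the generic rank `rank : K'₀ → ℤ`, `[F] ↦ dim_{K(X)} F_η` of an integral scheme (`KZeroCoh.genericRank`,
  `KTheory/CoherentGrothendieckGroupRank`; Hartshorne II Ex. 6.10 (b)): **`genericRank_pullback` — `rank(f^*y) = rank(y)`** for a
  flat morphism `f : X → Y` of integral locally noetherian schemes MAPPING THE GENERIC POINT TO THE GENERIC POINT (hypothesis
  `hη : f η_X = η_Y`, i.e. `f` dominant; stated, not derived), via the stalk formula `(f^*F)_x ≅ 𝒪_{X,x} ⊗_{𝒪_{Y,f x}} F_{f x}`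
  (Görtz–Wedhorn I (7.8.6), the tree's `Modules.stalkPullbackIso`) at `x = η_X` and `dim_{K(X)} (K(X) ⊗_{K(Y)} V) = dim_{K(Y)} V`
  (Mathlib `Module.finrank_baseChange`).

Library only (cell `pub-hodge-ring2`, count-neutral); proves nothing about any crux, route or conjecture.

## References

* U. Görtz, T. Wedhorn, *Algebraic Geometry II* (2023), Remark and Def. 23.52–23.53 (pp. 437–438). [GortzWedhorn2023]
* U. Görtz, T. Wedhorn, *Algebraic Geometry I*, 2nd ed. (2020), (7.8.6) (stalks of inverse images). [GortzWedhorn2020]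
* W. Fulton, *Intersection Theory* (1998), §15.1 (p. 281). [Fulton1998]
* R. Hartshorne, *Algebraic Geometry* (1977), II Ex. 6.10 (b) (p. 148). [Hartshorne1977]
* The Stacks Project, Tag 01CD (Modules, Lemma 17.16.4). [StacksProject]
-/

noncomputable section

set_option backward.isDefEq.respectTransparency false -- `Scheme.Modules` is not reducible (as in Mathlib)

open CategoryTheory CategoryTheory.Limits AlgebraicGeometry
open Literature.AlgebraicGeometry.Modules Literature.AlgebraicGeometry.Morphisms Literature.AlgebraicGeometry.Motives

universe u

namespace Literature.AlgebraicGeometry.KTheory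

namespace KZeroCoh

variable {X Y : Scheme.{u}} [IsLocallyNoetherian X] [IsLocallyNoetherian Y]

/-! ### §1 `f^*` is `K₀`-linear -/

/-- **`f^*([E] • [F]) = [f^*E] • f^*[F]`** for a vector bundle `E` and a coherent `F`: `f^*(E ⊗ F) ≅ f^*E ⊗ f^*F` (Stacks 01CD,
the tree's `PullbackTensorObjIso_holds`). [cite: StacksProject, Tag 01CD (Modules, Lemma 17.16.4)]
[cite: GortzWedhorn2023, Remark and Def. 23.52–23.53 (pp. 437–438)] -/
theorem pullback_smulHom_of_of (f : X ⟶ Y) [Flat f] {E F : Y.Modules} (hE : IsFiniteLocallyFree E) (hF : Coh F) :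
    pullback f (smulHom (KZero.of E hE) (KZeroCoh.of F hF)) =
      smulHom (KZero.map f (KZero.of E hE)) (pullback f (KZeroCoh.of F hF)) := by
  obtain ⟨i⟩ := PullbackTensorObjIso_holds f E
  rw [smulHom_of_of hE hF (Coh.tensorObj_of_isFiniteLocallyFree hE hF), pullback_of, KZero.map_of, pullback_of,
    smulHom_of_of (hE.pullback f) (coh_pullback f F hF)
      (Coh.tensorObj_of_isFiniteLocallyFree (hE.pullback f) (coh_pullback f F hF))]
  exact KZeroCoh.of_iso (i.app F) _ _

/-- **Flat pull-back is `K₀`-linear: `f^*(x • y) = f^*x • f^*y`** (`x ∈ K₀(Y)`, `y ∈ K'₀(Y)`, `f^*x = KZero.map f x`).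
[cite: GortzWedhorn2023, Remark and Def. 23.52–23.53 (pp. 437–438)] [cite: Fulton1998, §15.1 (p. 281)] -/
theorem pullback_smulHom (f : X ⟶ Y) [Flat f] (x : KZero Y) (y : KZeroCoh Y) :
    pullback f (smulHom x y) = smulHom (KZero.map f x) (pullback f y) := by
  induction x using KZero.induction_on with
  | zero => simp only [map_zero, AddMonoidHom.zero_apply]
  | of E hE =>
    induction y using KZeroCoh.induction_on with
    | zero => simp only [map_zero]
    | of F hF => exact pullback_smulHom_of_of f hE hF
    | neg y hy => simp only [map_neg, hy]
    | add y z hy hz => simp only [map_add, hy, hz]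
  | neg x hx => simp only [map_neg, AddMonoidHom.neg_apply, hx]
  | add x x' hx hx' => simp only [map_add, AddMonoidHom.add_apply, hx, hx']

/-! ### §2 `f^*` preserves the generic rank -/

variable [IsIntegral X] [IsIntegral Y]

omit [IsLocallyNoetherian X] [IsLocallyNoetherian Y] [IsIntegral X] [IsIntegral Y] in
/-- `dim_{𝒪_{Y,x}} F_x = dim_{𝒪_{Y,y}} F_y` for `x = y` (transport along an equality of points, e.g. `f η_X = η_Y`).
[folklore] -/
private theorem finrank_stalk_congr_point {x y : Y} (h : x = y) (F : Y.Modules) :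
    Module.finrank (Y.presheaf.stalk x) ((stalkFunctor x).obj F) =
      Module.finrank (Y.presheaf.stalk y) ((stalkFunctor y).obj F) := by
  subst h
  rfl

/-- **`rank [f^*F] = rank [F]`** for `f` flat between integral locally noetherian schemes with `f η_X = η_Y` and `F` coherent:
`(f^*F)_{η_X} ≅ K(X) ⊗_{K(Y)} F_{η_Y}` (Görtz–Wedhorn I (7.8.6)) has `K(X)`-dimension `dim_{K(Y)} F_{η_Y}`.
[cite: Hartshorne1977, II Ex. 6.10 (b) (p. 148)] [cite: GortzWedhorn2020, (7.8.6)] -/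
theorem genericRank_pullback_of (f : X ⟶ Y) [Flat f] (hη : f (genericPoint X) = genericPoint Y) (F : Y.Modules)
    (hF : Coh F) : genericRank (pullback f (KZeroCoh.of F hF)) = genericRank (KZeroCoh.of F hF) := by
  rw [pullback_of, genericRank_of, genericRank_of, ← finrank_stalk_congr_point hη F]
  -- the stalk formula at the generic point
  have e : ((stalkFunctor (genericPoint X)).obj ((Scheme.Modules.pullback f).obj F)) ≃ₗ[X.functionField]
      ((ModuleCat.extendScalars (f.stalkMap (genericPoint X)).hom).obj ((stalkFunctor (f (genericPoint X))).obj F)) :=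
    ((stalkPullbackIso f (genericPoint X)).app F).toLinearEquiv
  rw [LinearEquiv.finrank_eq e]
  -- `𝒪_{Y, f η_X}` is a field and `F_{f η_X}` a finite-dimensional vector space over it
  have hfield : IsField (Y.presheaf.stalk (f (genericPoint X))) := by
    rw [hη]; exact Field.toIsField _
  letI := hfield.toField
  haveI : Module.Finite (Y.presheaf.stalk (f (genericPoint X))) ((stalkFunctor (f (genericPoint X))).obj F) :=
    moduleFinite_stalk_of_coh _ hF
  letI : Algebra (Y.presheaf.stalk (f (genericPoint X))) (X.presheaf.stalk (genericPoint X)) :=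
    (f.stalkMap (genericPoint X)).hom.toAlgebra
  exact congrArg Nat.cast (Module.finrank_baseChange (R := X.presheaf.stalk (genericPoint X))
    (S := Y.presheaf.stalk (f (genericPoint X))) (M' := (stalkFunctor (f (genericPoint X))).obj F))

/-- **Flat dominant pull-back preserves the generic rank: `rank (f^* y) = rank y`** on `K'₀`, for `f` flat between integral
locally noetherian schemes with `f η_X = η_Y`. [cite: Hartshorne1977, II Ex. 6.10 (b) (p. 148)] [cite: GortzWedhorn2020, (7.8.6)] -/
theorem genericRank_pullback (f : X ⟶ Y) [Flat f] (hη : f (genericPoint X) = genericPoint Y) (y : KZeroCoh Y) :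
    genericRank (pullback f y) = genericRank y := by
  have h : genericRank.comp (pullback f) = genericRank :=
    KZeroCoh.hom_ext fun F hF => by rw [AddMonoidHom.comp_apply]; exact genericRank_pullback_of f hη F hF
  exact DFunLike.congr_fun h y

end KZeroCoh

end Literature.AlgebraicGeometry.KTheory

end
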